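import Summits.ABC.IUTFork.Repair.CandJoshi3Profile
import HarnessLib

/-!
# IUT REPAIR branch (rung LADDER-ABC:A2.RP), rows RP-J01a/b, RP-J02a — the Joshi-shaped candidates form a STRICT CHAIN between the residual
# of record and the hull: `S ⟹ H_J1 ⟹ (H_J2 ∧ H_J3) ⟹ Hull / Statement`, no converse

PROOF-ONLY record file (D-0012; no definition, no `Prop` fact) of the abc-iut cell, IUT REPAIR branch (seat abc-iut-rp-j1), written for the verdict-word
decision table of `HOME/plan/repair/APPENDIX-J.md` §J.1b (v0.4): it places the three sufficient Joshi-shaped hypotheses of `Repair/CandJoshi1.lean` (p427582: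
`JoshiDominance` = H_J1, `JoshiVolumeDominance` = H_J2) and `Repair/CandJoshi3.lean` (p428372: `LocusCovers` = H_J3) EXACTLY in the order of hypotheses
over the frozen interface, by kernel theorems only (composition of landed arrows; strictness by the landed models of record). TAKES NO SIDE on
[IUTchIII] Cor. 3.12 and on no author; typed ≠ proved; instantiated ≠ endorsed.

THE CHAIN (every lattice situation / setting / operator / datum; side conditions named):
* `S ⟹ H_J1` (`CandJoshi1.joshiDominance_of_pilotKummerIndRelated`: Thm. 3.11 (ii) (b) for the column + (hρ));
* `H_J1 ⟹ H_J2` (`CandJoshi1.joshiVolumeDominance_of_joshiDominance`: pins + bridge hypotheses) and `H_J1 ⟹ H_J3` (`CandJoshi3Profile.locusCovers_of_joshiDominance`: Θ-pin);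
  hence **`S ⟹ H_J2`** (`joshiVolumeDominance_of_pilotKummerIndRelated`) and **`S ⟹ H_J3`** (`locusCovers_of_pilotKummerIndRelated`), new here;
* `H_J3 ⟹ Hull` (`CandJoshi3.hull_of_locusCovers`) `⟹ Licence` (`licence_of_pilotKummerCompatHull`, q-pin) `⟹ Statement` (`statement_of_licence`);
  `H_J2 ⟹ Statement` (`CandJoshi1.statement_of_joshiVolumeDominance`, bridge hypotheses only).
STRICTNESS (models of record, `p = 2`; each satisfies typed Thm. 3.11 (i)–(iii), `BridgeHyps`, `AbsLogQPos`, the THREE pins):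
* at abc-iut-w4-d103's one-operator log-shell setting LS1(3) — H_J1 ∧ H_J2 ∧ H_J3 ∧ Statement ∧ **¬S** (`joshi_chain_strict_below`: abc-iut-w4-d098's
  `CandJoshi1Profile.joshi_candidates_hold_on_ls`, `CandJoshi3Profile.locusCovers_oneRho_iff`);
* at abc-iut-w4-d103's frame flip — Licence ∧ GapH3 ∧ Statement ∧ **¬H_J1 ∧ ¬H_J2 ∧ ¬H_J3** (`joshi_chain_strict_above`: `CandJoshi1Profile.not_joshiDominance_flip`,
  `not_joshiVolumeDominance_flip`, `CandJoshi3Profile.not_locusCovers_flip`).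
So, for §J.1b: the three rows are SUFFICIENT-FOR-HULL/STATEMENT and lie STRICTLY BETWEEN the residual `S` and the hull level — neither «≡ GapH3» (they fail
at the flip, where GapH3 holds) nor «incomparable with S» (S implies each). Their LS hold-set equals the Licence set `{d ≥ 3}` only because the LS family
is rigid (`CandJoshi3Profile.joshiDominance_of_locusCovers_of_rigid`). Interface/toy level; no judgement on print.
[claim: Joshi2024ATSIII, status: disputed] [claim: Joshi2021ATSII, status: disputed]
-/

noncomputable section

open Set

namespace Summit.ABC.IUTFork.Repair.CandJoshi1Order

open Thm311 Cor312 Cor312.Checks Cor312.IdentifiedNonVacuity Cor312Vol Literature.IUT.LogThetaLattice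
open Cor312Vol.NaiveWitness Cor312Vol.PinnedWitness Cor312Vol.PinnedHonest
open Summit.ABC.IUTFork.Repair.CandJoshi1 Summit.ABC.IUTFork.Repair.CandJoshi3 Summit.ABC.IUTFork.Repair.CandJoshi1Profile
open Summit.ABC.IUTFork.Repair.CandJoshi3Profile

/-! ## 1. The chain from the residual down to the Statement -/

section Chain

variable {T : ThetaIndex} (S : LatticeSituation T) (P : Cor312.Setting S.toSituation)
  (ρ : (∀ v : T.V, v ∈ T.Vbad → Set (S.L.StarPacket v)) → ∀ (j : T.Label) (vQ : T.VQ), Set (S.L.Packet j vQ))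
  (qK : ∀ v : T.V, v ∈ T.Vbad → Set (S.L.StarPacket v))

/-- **`S ⟹ H_J2`**: under Thm. 3.11 (ii) (b) for the column, the two region pins and the bridge hypotheses, the residual of record implies Joshi's
packetwise volume dominance (through H_J1). [folklore] -/
theorem joshiVolumeDominance_of_pilotKummerIndRelated (H : BridgeHyps P) (hKumB : (S.col P.n).KummerB (S.D P.n))
    (hpin : PinnedRegions S P ρ qK) (h : PilotKummerIndRelated S P ρ qK) : JoshiVolumeDominance P :=
  joshiVolumeDominance_of_joshiDominance S P ρ qK H hpin (joshiDominance_of_pilotKummerIndRelated S P ρ qK hKumB hpin.1.1 h)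

/-- **`S ⟹ H_J3`**: under Thm. 3.11 (ii) (b) for the column and the Θ-pin, the residual of record implies the covering of the q-region by the
theta-values locus (through H_J1). [folklore] -/
theorem locusCovers_of_pilotKummerIndRelated (hKumB : (S.col P.n).KummerB (S.D P.n)) (hΘ : ThetaPinned S P ρ)
    (h : PilotKummerIndRelated S P ρ qK) : LocusCovers S P ρ qK :=
  locusCovers_of_joshiDominance S P ρ qK hΘ (joshiDominance_of_pilotKummerIndRelated S P ρ qK hKumB hΘ.1 h)

/-- **THE CHAIN** `S ⟹ H_J1 ⟹ (H_J2 ∧ H_J3)`, `H_J3 ⟹ Hull ⟹ Licence ⟹ Statement`, `H_J2 ⟹ Statement` — on ANY lattice situation and setting, under Thm.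
3.11 (ii) (b) for the column, the two region pins and the bridge hypotheses (all landed arrows, composed). [folklore] -/
theorem joshi_chain (H : BridgeHyps P) (hKumB : (S.col P.n).KummerB (S.D P.n)) (hpin : PinnedRegions S P ρ qK) :
    (PilotKummerIndRelated S P ρ qK → JoshiDominance S P ρ qK) ∧
      (JoshiDominance S P ρ qK → JoshiVolumeDominance P ∧ LocusCovers S P ρ qK) ∧
      (LocusCovers S P ρ qK → PilotKummerCompatHull S P ρ qK) ∧
      (PilotKummerCompatHull S P ρ qK → Thm311ToCor312.Licence P) ∧
      (Thm311ToCor312.Licence P → P.Statement) ∧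
      (JoshiVolumeDominance P → P.Statement) :=
  ⟨joshiDominance_of_pilotKummerIndRelated S P ρ qK hKumB hpin.1.1,
    fun h => ⟨joshiVolumeDominance_of_joshiDominance S P ρ qK H hpin h, locusCovers_of_joshiDominance S P ρ qK hpin.1 h⟩,
    hull_of_locusCovers S P ρ qK, licence_of_pilotKummerCompatHull S P ρ qK hpin.2, Thm311ToCor312.statement_of_licence H,
    statement_of_joshiVolumeDominance P H⟩

end Chain

/-! ## 2. Strictness at both ends, on the models of record -/

section Strict

variable (p : ℕ) [hp : Fact p.Prime]

/-- **STRICT BELOW `S`**: at abc-iut-w4-d103's one-operator log-shell setting LS1(3) (typed Thm. 3.11, bridge hypotheses, `|log(q)| > 0`, the three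
pins) H_J1, H_J2, H_J3 and the Statement HOLD while the residual `S` FAILS — so none of the three is implied-back by, nor equivalent to, `S`.
[folklore] -/
theorem joshi_chain_strict_below :
    (naiveFull p).Statement ∧ BridgeHyps (shellSetting p 3) ∧ (shellSetting p 3).AbsLogQPos ∧
      PinnedRegions3 (naiveFull p).toLatticeSituation (shellSetting p 3) (rhoOne p 3) (qDatum p) ∧
      JoshiDominance (naiveFull p).toLatticeSituation (shellSetting p 3) (rhoOne p 3) (qDatum p) ∧
      JoshiVolumeDominance (shellSetting p 3) ∧
      LocusCovers (naiveFull p).toLatticeSituation (shellSetting p 3) (rhoOne p 3) (qDatum p) ∧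
      Summit.ABC.IUTFork.Cor312.Setting.Statement (shellSetting p 3) ∧
      ¬ PilotKummerIndRelated (naiveFull p).toLatticeSituation (shellSetting p 3) (rhoOne p 3) (qDatum p) := by
  obtain ⟨h1, h2, h3, h4, h5, h6, h7, -, h9⟩ := joshi_candidates_hold_on_ls p 3 le_rfl
  exact ⟨h1, h2, h3, h4, h5, h6, (locusCovers_oneRho_iff p 3).2 le_rfl, h7, h9⟩

/-- **STRICT ABOVE THE HULL**: at abc-iut-w4-d103's frame flip (typed Thm. 3.11, bridge hypotheses, `|log(q)| > 0`, the three pins) the Licence,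
`GapH3` and the Statement HOLD while H_J1, H_J2, H_J3 all FAIL — so none of the three is implied by, nor equivalent to, the hull level. [folklore] -/
theorem joshi_chain_strict_above :
    (naiveFull p).Statement ∧ BridgeHyps (flipSetting p) ∧ (flipSetting p).AbsLogQPos ∧
      PinnedRegions3 (naiveFull p).toLatticeSituation (flipSetting p) (orbitRegion p) (qDatum p) ∧
      Thm311ToCor312.Licence (flipSetting p) ∧ GapH3 (naiveFull p).toLatticeSituation (flipSetting p) (orbitRegion p) (qDatum p) ∧
      Summit.ABC.IUTFork.Cor312.Setting.Statement (flipSetting p) ∧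
      ¬ JoshiDominance (naiveFull p).toLatticeSituation (flipSetting p) (orbitRegion p) (qDatum p) ∧
      ¬ JoshiVolumeDominance (flipSetting p) ∧
      ¬ LocusCovers (naiveFull p).toLatticeSituation (flipSetting p) (orbitRegion p) (qDatum p) :=
  ⟨naiveFull_statement p, flip_bridgeHyps p, flip_absLogQPos p, flip_pinnedRegions3 p, flip_licence p, flip_gapH3 p, flip_statement p,
    not_joshiDominance_flip p, not_joshiVolumeDominance_flip p, not_locusCovers_flip p⟩

/-- **FOR §J.1b (the census sentence in one theorem, `p = 2`)**: the Joshi-shaped candidates are STRICTLY BETWEEN the residual and the hull —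
(a) on every situation S ⟹ H_J1 ⟹ H_J2 ∧ H_J3 ⟹ … ⟹ Statement (`joshi_chain`); (b) a pinned model of record with H_J1 ∧ H_J2 ∧ H_J3 ∧ Statement ∧ ¬S;
(c) a pinned model of record with Licence ∧ GapH3 ∧ Statement ∧ ¬H_J1 ∧ ¬H_J2 ∧ ¬H_J3. [claim: Joshi2024ATSIII, status: disputed] -/
theorem joshi_candidates_strictly_between :
    (∃ (P : Cor312.Setting (naiveFull 2).toLatticeSituation.toSituation) (ρ : _) (qK : _),
        BridgeHyps P ∧ P.AbsLogQPos ∧ PinnedRegions3 (naiveFull 2).toLatticeSituation P ρ qK ∧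
        JoshiDominance (naiveFull 2).toLatticeSituation P ρ qK ∧ JoshiVolumeDominance P ∧ LocusCovers (naiveFull 2).toLatticeSituation P ρ qK ∧
        P.Statement ∧ ¬ PilotKummerIndRelated (naiveFull 2).toLatticeSituation P ρ qK) ∧
    (∃ (P : Cor312.Setting (naiveFull 2).toLatticeSituation.toSituation) (ρ : _) (qK : _),
        BridgeHyps P ∧ P.AbsLogQPos ∧ PinnedRegions3 (naiveFull 2).toLatticeSituation P ρ qK ∧
        Thm311ToCor312.Licence P ∧ P.Statement ∧
        ¬ JoshiDominance (naiveFull 2).toLatticeSituation P ρ qK ∧ ¬ JoshiVolumeDominance P ∧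
        ¬ LocusCovers (naiveFull 2).toLatticeSituation P ρ qK) := by
  haveI : Fact (Nat.Prime 2) := ⟨Nat.prime_two⟩
  obtain ⟨-, b2, b3, b4, b5, b6, b7, b8, b9⟩ := joshi_chain_strict_below 2
  obtain ⟨-, a2, a3, a4, a5, -, a7, a8, a9, a10⟩ := joshi_chain_strict_above 2
  exact ⟨⟨shellSetting 2 3, rhoOne 2 3, qDatum 2, b2, b3, b4, b5, b6, b7, b8, b9⟩,
    ⟨flipSetting 2, orbitRegion 2, qDatum 2, a2, a3, a4, a5, a7, a8, a9, a10⟩⟩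

end Strict

end Summit.ABC.IUTFork.Repair.CandJoshi1Order

end
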